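import Literature.RepresentationTheory.HeisenbergGroup.SchrodingerCommutantPi
import Literature.NumberTheory.Automorphic.FiniteAdeleSchrodingerIrreducible
import HarnessLib

/-!
# Rank `n`: the smooth Schrödinger model on `𝒮(F^ι)` is IRREDUCIBLE (MVW Chap. 2 I.3)

Topic `RepresentationTheory/HeisenbergGroup`; namespace `Literature.RepresentationTheory.HeisenbergGroup`.  KERNEL ONLY:
theorems, no definition, no named fact, no `sorry`.

`F` a non-archimedean local field, `ι` a finite index type, `ψ` a continuous non-trivial character (conductor `𝔭^m`),
`ρ = schrodingerSB (dotProductBilin F F) ψ` the smooth Schrödinger model of the Heisenberg group of `W = F^ι ⊕ F^ι` on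
`𝒮(F^ι)` (`(ρ((x,y),t) Φ)(u) = ψ(t + ⟨u, y⟩) Φ(u + x)`).  `SchrodingerCommutantPi.lean` proves that its COMMUTANT is
`ℂ`; this file proves the (logically independent, for a non-unitary algebraic statement) INVARIANT-SUBSPACE form of
[MoeglinVignerasWaldspurger1987, Chap. 2 I.3] «Soient `S'` un sous-espace non nul de `S_A` invariant par `H` … on
obtient `f_{w,L} ∈ S'`.  Ces fonctions engendrant `S_A`, on a `S' = S_A`», the local twin of the finite-adelic
`Literature.NumberTheory.Automorphic.eq_top_of_invariant` (`FiniteAdeleSchrodingerIrreducible.lean`), whose Fourier-free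
proof through the elimination lemma `smul_mem_of_forall_sum_smul_mem` is followed verbatim with the boxes `(𝔭^N)^ι`:

* `piBallSB_mem_of_mem` — ISOLATION: if `W ≤ 𝒮(F^ι)` is stable under the modulations and `g ∈ W` is `(𝔭^N)^ι`-invariant
  with `g(0) ≠ 0`, then `1_{(𝔭^N)^ι} ∈ W`: write `g = Σ_B g(a_B) 1_B` over finitely many cosets `B = a_B + (𝔭^N)^ι`
  (`exists_finset_eq_sum_indicator_pi`); modulating by `y ∈ (𝔭^{m-N})^ι` multiplies the `B`-th term by
  `ψ(⟨a_B, y⟩)` (the conductor), these characters of `(𝔭^{m-N})^ι` are pairwise distinct for distinct cosets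
  (`exists_mem_primePowBall_addChar_mul_ne_one` at one coordinate), so the elimination lemma puts every term in `W`;
* `piBallSB_mem_of_piBallSB_mem` — smaller boxes: `1_{(𝔭^N)^ι} ∈ W ⇒ 1_{(𝔭^{N'})^ι} ∈ W` for `N ≤ N'`;
* **`eq_top_of_invariant_pi`** / `eq_bot_or_eq_top_of_invariant_pi` — a subspace stable under all translations
  `ρ(x,0,0)` and modulations `ρ(0,y,0)` is `⊥` or `⊤`; `eq_bot_or_eq_top_of_invariant_schrodingerSB_pi` — the same for
  a subspace stable under all `ρ(h)`.

Written for the cell `hodgecm-mathlib` (fan B, rung B-IV): it is the fibre input of the Heisenberg-parabolic proof of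
`MoeglinVignerasWaldspurger1987.mvw_IV4_rankOne_irreducibleOrZero` (the stalks of the theta lift along the root group
of an isotropic line are Schrödinger modules of the smaller Heisenberg group).  Nothing about theta lifts is asserted here.

## References
* [MoeglinVignerasWaldspurger1987] C. Mœglin, M.-F. Vignéras, J.-L. Waldspurger, *Correspondances de Howe sur un corps
  p-adique*, LNM 1291 (1987), Chap. 2 I.3 (irréductibilité de `ρ` sur `S_A`), I.4 Exemple (1).
* [Weil1964] A. Weil, Acta Math. 111 (1964), Chap. I n° 11 (`𝒮(X)` and its standard functions).
-/

set_option autoImplicit false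

noncomputable section

namespace Literature.RepresentationTheory.HeisenbergGroup

open Literature.NumberTheory.Automorphic
open Literature.NumberTheory.GaloisRepresentations.IsNonarchimedeanLocalField
open scoped Pointwise

section Irreducible

variable {F : Type*} [Field F] [ValuativeRel F] [TopologicalSpace F] [IsNonarchimedeanLocalField F]
  {ι : Type*} [Fintype ι]
  {ψ : AddChar F Circle} (hl : IsLocallyConstant (⇑ψ : F → Circle))
  (hb : ∀ y : ι → F, Continuous fun u : ι → F => dotProductBilin F F u y)

/-- the coset indicator `1_{a + (𝔭^N)^ι}` is the translate `ρ(-a, 0, 0) 1_{(𝔭^N)^ι}`.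
[cite: MoeglinVignerasWaldspurger1987, Chap. 2 I.4 Exemple (1)] -/
theorem schrodingerSB_piTransl_neg_piBallSB_apply (a : ι → F) (N : ℤ) (u : ι → F) :
    ((schrodingerSB (dotProductBilin F F) ψ hl hb (piTransl (-a)) (piBallSB F ι N) : SchwartzBruhat (ι → F)) :
        (ι → F) → ℂ) u = (a +ᵥ piPrimePowBall F ι N).indicator (fun _ => (1 : ℂ)) u := by
  rw [schrodingerSB_piTransl_apply, coe_piBallSB]
  by_cases hu : u ∈ a +ᵥ piPrimePowBall F ι N
  · have hu' : u + -a ∈ piPrimePowBall F ι N := by rw [← sub_eq_add_neg]; exact (mem_vadd_piPrimePowBall_iff).1 hu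
    rw [Set.indicator_of_mem hu, Set.indicator_of_mem hu']
  · have hu' : u + -a ∉ piPrimePowBall F ι N := fun h => hu ((mem_vadd_piPrimePowBall_iff).2 (by rwa [sub_eq_add_neg]))
    rw [Set.indicator_of_notMem hu, Set.indicator_of_notMem hu']

/-- on a coset `B = a + (𝔭^N)^ι` the modulation by `y ∈ (𝔭^{m-N})^ι` is the scalar `ψ(⟨a, y⟩)` (conductor `𝔭^m`):
`ψ(⟨u, y⟩) 1_B(u) = ψ(⟨a, y⟩) 1_B(u)`. [cite: MoeglinVignerasWaldspurger1987, Chap. 2 I.3] -/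
theorem addChar_dotProduct_mul_indicator_vadd {m : ℤ} (hm : ψ.HasConductorExp m) {N : ℤ} (a : ι → F)
    {y : ι → F} (hy : y ∈ piPrimePowBall F ι (m - N)) (u : ι → F) :
    (ψ (u ⬝ᵥ y) : ℂ) * (a +ᵥ piPrimePowBall F ι N).indicator (fun _ => (1 : ℂ)) u =
      (ψ (a ⬝ᵥ y) : ℂ) * (a +ᵥ piPrimePowBall F ι N).indicator (fun _ => (1 : ℂ)) u := by
  by_cases hu : u ∈ a +ᵥ piPrimePowBall F ι N
  · have hua : u - a ∈ piPrimePowBall F ι N := (mem_vadd_piPrimePowBall_iff).1 hu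
    have hψ1 : ψ ((u - a) ⬝ᵥ y) = 1 := by
      refine hm.1 _ ?_
      have := dotProduct_mem_primePowBall hua hy
      rwa [add_sub_cancel] at this
    have e : u ⬝ᵥ y = a ⬝ᵥ y + (u - a) ⬝ᵥ y := by rw [sub_dotProduct]; ring
    rw [e, AddChar.map_add_eq_mul, hψ1, mul_one]
  · rw [Set.indicator_of_notMem hu, mul_zero, mul_zero]

/-- distinct cosets of `(𝔭^N)^ι` have distinct eigencharacters on `(𝔭^{m-N})^ι`: if `a - a' ∉ (𝔭^N)^ι` then
`ψ(⟨a, y⟩) ≠ ψ(⟨a', y⟩)` for some `y ∈ (𝔭^{m-N})^ι` (the conductor, at one coordinate).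
[cite: MoeglinVignerasWaldspurger1987, Chap. 2 I.3] -/
theorem exists_mem_piPrimePowBall_addChar_dotProduct_ne [DecidableEq ι] {m : ℤ} (hm : ψ.HasConductorExp m)
    {N : ℤ} {a a' : ι → F} (h : a - a' ∉ piPrimePowBall F ι N) :
    ∃ y ∈ piPrimePowBall F ι (m - N), (ψ (a ⬝ᵥ y) : ℂ) ≠ (ψ (a' ⬝ᵥ y) : ℂ) := by
  rw [mem_piPrimePowBall_iff] at h
  push Not at h
  obtain ⟨i, hi⟩ := h
  have hi' : (a - a') i ∉ primePowBall F (m - (m - N)) := by rwa [sub_sub_cancel]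
  obtain ⟨x₀, hx₀, hne⟩ := exists_mem_primePowBall_addChar_mul_ne_one hm hi'
  refine ⟨Pi.single i x₀, single_mem_piPrimePowBall i hx₀, fun heq => hne ?_⟩
  rw [dotProduct_single, dotProduct_single] at heq
  have hq : (ψ (a i * x₀) : ℂ) / (ψ (a' i * x₀) : ℂ) = 1 := by
    rw [heq, div_self (Circle.coe_ne_zero _)]
  rw [← Circle.coe_div, ← AddChar.map_sub_eq_div, ← sub_mul] at hq
  rw [Pi.sub_apply, mul_comm]
  exact Circle.coe_inj.1 (by rw [Circle.coe_one]; exact hq)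

/-- **Isolation.**  Let `W ≤ 𝒮(F^ι)` be stable under the modulations `ρ(0,y,0)`, `y ∈ (𝔭^{m-N})^ι`, and let `g ∈ W` be
`(𝔭^N)^ι`-invariant with `g(0) ≠ 0`.  Then `1_{(𝔭^N)^ι} ∈ W`: the step decomposition `g = Σ_B g(a_B) 1_B`, modulated
by `y`, is `Σ_B ψ(⟨a_B, y⟩) g(a_B) 1_B` with pairwise distinct characters, so the elimination lemma isolates every
term, in particular the one through `0`. [cite: MoeglinVignerasWaldspurger1987, Chap. 2 I.3] -/
theorem piBallSB_mem_of_mem {m : ℤ} (hm : ψ.HasConductorExp m) (W : Submodule ℂ (SchwartzBruhat (ι → F))) {N : ℤ}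
    (hmod : ∀ y ∈ piPrimePowBall F ι (m - N), ∀ f ∈ W, schrodingerSB (dotProductBilin F F) ψ hl hb (piModul y) f ∈ W)
    {g : SchwartzBruhat (ι → F)} (hg : g ∈ W)
    (hinv : ∀ x, ∀ t ∈ piPrimePowBall F ι N, (g : (ι → F) → ℂ) (x + t) = (g : (ι → F) → ℂ) x)
    (hg0 : (g : (ι → F) → ℂ) 0 ≠ 0) :
    piBallSB F ι N ∈ W := by
  classical
  obtain ⟨C, rep, hrep, hsum⟩ := exists_finset_eq_sum_const_mul_indicator_pi_of_forall_add_eq g.2 hinv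
  -- the lattice `Λ = (𝔭^{m-N})^ι` as an additive group
  let Λ : AddSubgroup (ι → F) :=
    { carrier := piPrimePowBall F ι (m - N)
      add_mem' := fun ha hb => add_mem_piPrimePowBall ha hb
      zero_mem' := zero_mem_piPrimePowBall _
      neg_mem' := fun ha => neg_mem_piPrimePowBall ha }
  -- the terms of the step decomposition
  let e : Set (ι → F) → SchwartzBruhat (ι → F) := fun B =>
    schrodingerSB (dotProductBilin F F) ψ hl hb (piTransl (-rep B)) (piBallSB F ι N)
  have hcoe : ∀ B ∈ C, ∀ u, ((e B : SchwartzBruhat (ι → F)) : (ι → F) → ℂ) u = B.indicator (fun _ => (1 : ℂ)) u := by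
    intro B hB u
    rw [schrodingerSB_piTransl_neg_piBallSB_apply, ← hrep B hB]
  have hg' : g = ∑ B ∈ C, (g : (ι → F) → ℂ) (rep B) • e B := by
    apply Subtype.ext
    rw [AddSubmonoidClass.coe_finsetSum]
    funext u
    rw [hsum u, Finset.sum_apply]
    exact Finset.sum_congr rfl fun B hB => by rw [Submodule.coe_smul, Pi.smul_apply, smul_eq_mul, hcoe B hB u]
  -- every term lies in `W`
  have hterm : ∀ B ∈ C, (g : (ι → F) → ℂ) (rep B) • e B ∈ W := by
    refine smul_mem_of_forall_sum_smul_mem W (fun (B : Set (ι → F)) (y : Λ) => (ψ (rep B ⬝ᵥ (y : ι → F)) : ℂ))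
      ?_ ?_ e C (fun B => (g : (ι → F) → ℂ) (rep B)) ?_ ?_
    · intro B y y'
      rw [AddSubgroup.coe_add, dotProduct_add, AddChar.map_add_eq_mul, Circle.coe_mul]
    · intro B
      rw [AddSubgroup.coe_zero, dotProduct_zero, AddChar.map_zero_eq_one, Circle.coe_one]
    · intro B hB B' hB' hne
      have h : rep B - rep B' ∉ piPrimePowBall F ι N := by
        intro hmem
        apply hne
        rw [hrep B hB, hrep B' hB']
        exact vadd_piPrimePowBall_eq_of_mem ((mem_vadd_piPrimePowBall_iff).2 hmem)
      obtain ⟨y, hy, hne'⟩ := exists_mem_piPrimePowBall_addChar_dotProduct_ne hm h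
      exact ⟨⟨y, hy⟩, hne'⟩
    · intro y
      have hcalc : schrodingerSB (dotProductBilin F F) ψ hl hb (piModul (y : ι → F)) g =
          ∑ B ∈ C, ((g : (ι → F) → ℂ) (rep B) * (ψ (rep B ⬝ᵥ (y : ι → F)) : ℂ)) • e B := by
        apply Subtype.ext
        funext u
        rw [schrodingerSB_piModul_apply, hsum u, AddSubmonoidClass.coe_finsetSum, Finset.sum_apply, Finset.mul_sum]
        refine Finset.sum_congr rfl fun B hB => ?_
        have hind : B.indicator (fun _ => (1 : ℂ)) u = (rep B +ᵥ piPrimePowBall F ι N).indicator (fun _ => (1 : ℂ)) u := by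
          rw [← hrep B hB]
        rw [Submodule.coe_smul, Pi.smul_apply, smul_eq_mul, hcoe B hB u, mul_left_comm, hind,
          addChar_dotProduct_mul_indicator_vadd hm (rep B) y.2 u]
        ring
      have h := hmod y y.2 g hg
      rw [hcalc] at h
      exact h
  -- the coset through `0` occurs, with coefficient `g(0)`
  have h0mem : ∃ B₀ ∈ C, (0 : ι → F) ∈ B₀ := by
    by_contra h
    push Not at h
    apply hg0
    rw [hsum 0]
    exact Finset.sum_eq_zero fun B hB => by rw [Set.indicator_of_notMem (h B hB), mul_zero]
  obtain ⟨B₀, hB₀C, h0B₀⟩ := h0mem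
  have hrep0 : -rep B₀ ∈ piPrimePowBall F ι N := by
    have h := (mem_vadd_piPrimePowBall_iff (a := rep B₀) (v := (0 : ι → F))).1 (by rw [← hrep B₀ hB₀C]; exact h0B₀)
    rwa [zero_sub] at h
  have hgrep : (g : (ι → F) → ℂ) (rep B₀) = (g : (ι → F) → ℂ) 0 := by
    have h := hinv (rep B₀) (-rep B₀) hrep0
    rw [add_neg_cancel] at h
    exact h.symm
  have heB₀ : e B₀ = piBallSB F ι N := by
    apply Subtype.ext
    funext u
    rw [hcoe B₀ hB₀C u, coe_piBallSB, hrep B₀ hB₀C]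
    have hset : rep B₀ +ᵥ piPrimePowBall F ι N = piPrimePowBall F ι N := by
      have h := vadd_piPrimePowBall_eq_of_mem (N := N) (a := rep B₀) (u := 0)
        ((mem_vadd_piPrimePowBall_iff).2 (by rwa [zero_sub]))
      rw [← h, zero_vadd]
    rw [hset]
  have h := hterm B₀ hB₀C
  rw [heB₀, hgrep] at h
  have h' := W.smul_mem ((g : (ι → F) → ℂ) 0)⁻¹ h
  rwa [smul_smul, inv_mul_cancel₀ hg0, one_smul] at h'

/-- **smaller boxes**: if `1_{(𝔭^N)^ι} ∈ W` (modulation-stable `W`) then `1_{(𝔭^{N'})^ι} ∈ W` for every `N' ≥ N`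
(isolation applied to the `(𝔭^{N'})^ι`-invariant vector `1_{(𝔭^N)^ι}`). [cite: MoeglinVignerasWaldspurger1987, Chap. 2 I.3] -/
theorem piBallSB_mem_of_piBallSB_mem {m : ℤ} (hm : ψ.HasConductorExp m) (W : Submodule ℂ (SchwartzBruhat (ι → F)))
    (hmod : ∀ y f, f ∈ W → schrodingerSB (dotProductBilin F F) ψ hl hb (piModul y) f ∈ W)
    {N N' : ℤ} (hNN' : N ≤ N') (hN : piBallSB F ι N ∈ W) : piBallSB F ι N' ∈ W :=
  piBallSB_mem_of_mem hl hb hm W (fun y _ f hf => hmod y f hf) hN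
    (fun x t ht => by rw [coe_piBallSB]; exact indicator_piPrimePowBall_add_eq hNN' x ht)
    (by rw [coe_piBallSB, Set.indicator_of_mem (zero_mem_piPrimePowBall N)]; exact one_ne_zero)

/-- **Irreducibility of the smooth Schrödinger model on `𝒮(F^ι)`**: a subspace stable under all translations
`ρ(x,0,0)` and all modulations `ρ(0,y,0)` and non-zero is everything. [cite: MoeglinVignerasWaldspurger1987, Chap. 2 I.3] -/
theorem eq_top_of_invariant_pi (hψ : ψ.IsContinuousNontrivial) (W : Submodule ℂ (SchwartzBruhat (ι → F)))
    (htr : ∀ x f, f ∈ W → schrodingerSB (dotProductBilin F F) ψ hl hb (piTransl x) f ∈ W)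
    (hmod : ∀ y f, f ∈ W → schrodingerSB (dotProductBilin F F) ψ hl hb (piModul y) f ∈ W) (hW : W ≠ ⊥) :
    W = ⊤ := by
  classical
  obtain ⟨m, hm⟩ := hψ.exists_hasConductorExp
  -- a vector of `W` not vanishing at `0`
  obtain ⟨f, hfW, hf0⟩ := (Submodule.ne_bot_iff W).1 hW
  have hx : ∃ x₀, (f : (ι → F) → ℂ) x₀ ≠ 0 := by
    by_contra h
    push Not at h
    exact hf0 (Subtype.ext (funext fun x => by rw [h x]; rfl))
  obtain ⟨x₀, hx₀⟩ := hx
  set g := schrodingerSB (dotProductBilin F F) ψ hl hb (piTransl x₀) f with hg_def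
  have hgW : g ∈ W := htr x₀ f hfW
  have hg0 : (g : (ι → F) → ℂ) 0 ≠ 0 := by
    rw [hg_def, schrodingerSB_piTransl_apply, zero_add]
    exact hx₀
  -- its level `N`: `1_{(𝔭^N)^ι} ∈ W`
  obtain ⟨N, hN⟩ := exists_forall_add_eq_of_mem_schwartzBruhat_pi g.2
  have hball : piBallSB F ι N ∈ W := piBallSB_mem_of_mem hl hb hm W (fun y _ f hf => hmod y f hf) hgW hN hg0
  -- an arbitrary `u` is a finite combination of translates of `1_{(𝔭^{N'})^ι}` for a common level `N' ≥ N`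
  refine eq_top_iff.2 fun u _ => ?_
  obtain ⟨Nu, hNu⟩ := exists_forall_add_eq_of_mem_schwartzBruhat_pi u.2
  have hN' : piBallSB F ι (max N Nu) ∈ W := piBallSB_mem_of_piBallSB_mem hl hb hm W hmod (le_max_left N Nu) hball
  obtain ⟨C, rep, hrep, hsum⟩ := exists_finset_eq_sum_const_mul_indicator_pi_of_forall_add_eq u.2
    (forall_add_eq_of_le_pi (le_max_right N Nu) hNu)
  have hu' : u = ∑ B ∈ C, (u : (ι → F) → ℂ) (rep B) •
      schrodingerSB (dotProductBilin F F) ψ hl hb (piTransl (-rep B)) (piBallSB F ι (max N Nu)) := by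
    apply Subtype.ext
    rw [AddSubmonoidClass.coe_finsetSum]
    funext x
    rw [hsum x, Finset.sum_apply]
    refine Finset.sum_congr rfl fun B hB => ?_
    rw [Submodule.coe_smul, Pi.smul_apply, smul_eq_mul, schrodingerSB_piTransl_neg_piBallSB_apply, ← hrep B hB]
  rw [hu']
  exact W.sum_mem fun B _ => W.smul_mem _ (htr _ _ hN')

/-- The dichotomy form: a translation- and modulation-stable subspace of `𝒮(F^ι)` is `⊥` or `⊤`.
[cite: MoeglinVignerasWaldspurger1987, Chap. 2 I.3] -/
theorem eq_bot_or_eq_top_of_invariant_pi (hψ : ψ.IsContinuousNontrivial) (W : Submodule ℂ (SchwartzBruhat (ι → F)))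
    (htr : ∀ x f, f ∈ W → schrodingerSB (dotProductBilin F F) ψ hl hb (piTransl x) f ∈ W)
    (hmod : ∀ y f, f ∈ W → schrodingerSB (dotProductBilin F F) ψ hl hb (piModul y) f ∈ W) :
    W = ⊥ ∨ W = ⊤ :=
  or_iff_not_imp_left.2 (eq_top_of_invariant_pi hl hb hψ W htr hmod)

/-- **The smooth Schrödinger representation of `H(F^ι ⊕ F^ι)` on `𝒮(F^ι)` is irreducible**: a subspace stable under
every `ρ(h)` is `⊥` or `⊤`. [cite: MoeglinVignerasWaldspurger1987, Chap. 2 I.3] -/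
theorem eq_bot_or_eq_top_of_invariant_schrodingerSB_pi (hψ : ψ.IsContinuousNontrivial)
    (W : Submodule ℂ (SchwartzBruhat (ι → F)))
    (hW : ∀ (h : Heisenberg (polar (dotProductBilin F F (m := ι)))) (f : SchwartzBruhat (ι → F)), f ∈ W →
      schrodingerSB (dotProductBilin F F) ψ hl hb h f ∈ W) :
    W = ⊥ ∨ W = ⊤ :=
  eq_bot_or_eq_top_of_invariant_pi hl hb hψ W (fun _ f hf => hW _ f hf) (fun _ f hf => hW _ f hf)

end Irreducible

end Literature.RepresentationTheory.HeisenbergGroup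

end
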